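import Summits.QuantumFields.BalabanUV.T4Continuum.Support.BlockAveragePushDirGauge
import Literature.MathematicalPhysics.QuantumFieldTheory.Balaban1983to89.B7Prop3Flat
import HarnessLib

/-!
# T⁴ programme, node NE3, row S6-Y7 (P3 leaf L7 «SLOP», k-level input (K2)) — THE FRAME SPLIT OF THE LINEARISED AVERAGE
# `pushDir = gaugeDir (cavg W) (frameLin ∘ L·) + dbarLin`, AND ITS FLAT-BACKGROUND SANITY: `dbarLin 1 = L·Q₀` (B7 (122)∕(125)),
# `‖L·Q₀‖_{sup→sup} ≤ L`, `‖L·Q₀‖_{ℓ¹→ℓ¹} ≤ L^{1−d}` (`BlockAveragePushDirSplit`)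

Cell `pub-balaban`, NE3 formalisation swarm (`t4/formal/NE3/LEAVES.md` row S5∕S6, sub-row S6-Y7; unit
`b2b-balaban-t4-ne3-formalise-leaf-10`, gen 2); sequel of `BlockAveragePushDirGauge` ((K1): `pushDir` is exactly covariant on
gauge directions).  The k-level architecture of SHAPE `Statements/S6-Y7-SHAPE-v1.md` §2′ splits the linearisation `P_W = pushDir L W`
of (42) into a GAUGE PART at the coarse sites, generated by the LINEARISED FRAMES
`frameLin L W Y y = Σ_{x ∈ B(y)} L^{−d} (δ_Y W)(Γ_{y,x})` (B7 (110)∕(112) TYPE: the first-order term of the block frame `v(y)`), and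
a remainder `dbarLin := pushDir − gaugeDir (cavg W) (frameLin ∘ L·)` — the linearised DOUBLE-BAR average (B7 (89)∕(120) TYPE).
THIS FILE: §1 the definitions and the split (an identity by definition); §2 THE FLAT BACKGROUND `W ≡ 1`: the linearised
transport is the abelian contour sum (`dhol 1 = asum`), `pushDir L 1 Y = Tside L Y` (B7 (47)–(48)), `frameLin L 1 = Fhat L`, and
**`dbarLin L 1 Y = linQ L Y`** — Bałaban's `L·(Q₀Y)_c = Σ_{x∈B(c₋)} L^{−d} Y([x, x + Le_κ])` ((122)∕(125), tree
`B7Prop3Flat.frame_cancellation` BY NAME): only the STRAIGHT SEGMENTS survive the split; §3 the two operator norms of the flat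
main term: `‖linQ L Y c‖ ≤ L·sup‖Y‖` (`B7Prop3Flat.norm_linQ_le` BY NAME) and, on the torus, the EXACT `ℓ¹` CONTRACTION
`Σ_{y∈[0,M)^d} Σ_κ ‖linQ L Y (L·y, κ)‖ ≤ L^{1−d} · Σ_{x∈[0,LM)^d} Σ_κ ‖Y(x,κ)‖` (`sum_period_norm_linQ_le`) — the located point of
SHAPE v1 §2 in kernel form: smooth directions are amplified by `L`, localised ones contracted by `L^{1−d}`, and the frames carry
the rest as gauge components (evaluated, not propagated, by (K1)).  The curved-background bounds of `dbarLin` ((K3)) are NOT here.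

HONEST FRAMING: finite-`T⁴` kinematics of ONE block-averaging step on ONE lattice (rung (B)+1 — NOT infinite volume, NOT a
mass gap, NOT Clay); identities and two elementary counts; nothing of NE3 is claimed (NE3-E stays CONDITIONAL on the co-owners'
⟨named structures⟩; the k-level L7(a) stays OPEN ∕ a typed binder of road P3); no `BetaPertH`, no (B), no G-an2-4; no printed
sentence is a hypothesis ([cite:] tags are context).  PLACEMENT (human rule 2026-08-19): our work, under `Summits/QuantumFields/BalabanUV/`.
-/

set_option autoImplicit false

open scoped BigOperators Matrix.Norms.L2Operator Topology
open NormedSpace Finset Filter Metric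

namespace Summit.QuantumFields.BalabanUV.T4Continuum.BlockAveragePushDirSplit

open Literature.MathematicalPhysics.QuantumFieldTheory.Balaban1983to89
open B7Prop1Explicit B7Prop2Explicit MatrixLog UnitaryModel
open T4AveragingDeficitWall hiding Site Plane Plaq Bond
open T4AveragingDeficitWallBoundary (periodBox blockSites_periodBox sum_blocks_eq sum_periodBox_shift)
open AveragingDeficitPeriodicCounting (IsPeriodicDir)
open AveragingDeficitTransport (dhol dhol_nil dhol_cons dstep)
open AveragingDeficitSideDeriv (jexp loopWord mlogDeriv XavgDeriv sideDeriv jexp_mlog_eq_Ad)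
open AveragingDeficitResidualPairing (pushDir)
open AveragingDeficitChartCalculus (cavg)
open B7Prop3Flat (Fhat linQ frame_cancellation norm_linQ_le)
open BlockAveragePushDirGauge (gaugeDir)

noncomputable section

variable {d : ℕ} {n : Type*} [Fintype n] [DecidableEq n]

/-! ## §1 The linearised frames and the split -/

/-- THE LINEARISED BLOCK FRAME at the site `y`: `frameLin L W Y y = Σ_{x ∈ B(y)} L^{−d} (δ_Y W)(Γ_{y,x})`, the first-order term of
`v(y) = exp[Σ_x L^{−d} log (R_{0,y}W e^{Y})(Γ_{y,x})]` (B7 (110)∕(112) TYPE; `Γ_{y,x}` = `treeWord (x − y)`). [folklore] -/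
def frameLin (L : ℕ) (W : Site d → Fin d → (Matrix n n ℂ)ˣ) (Y : Site d → Fin d → Matrix n n ℂ) (y : Site d) : Matrix n n ℂ :=
  ∑ r : Fin d → Fin L, (((L : ℝ) ^ d)⁻¹) • dhol W Y y (treeWord (boxVec L r))

/-- THE LINEARISED DOUBLE-BAR AVERAGE: the linearisation `pushDir` of (42) with the gauge component generated by the frames at
the two ends of the coarse bond removed,
`dbarLin L W Y (q, κ) = pushDir L W Y (q, κ) − (Ad_{V̄(c)⁻¹} frameLin(q) − frameLin(q + Le_κ))` (B7 (89)∕(120) TYPE). [folklore] -/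
def dbarLin (L : ℕ) (W : Site d → Fin d → (Matrix n n ℂ)ˣ) (Y : Site d → Fin d → Matrix n n ℂ) (q : Site d) (κ : Fin d) :
    Matrix n n ℂ :=
  pushDir L W Y q κ - (Ad (bavg L W q κ)⁻¹ (frameLin L W Y q) - frameLin L W Y (q + (L : ℤ) • e κ))

/-- **THE SPLIT**: `pushDir = (frame gauge part) + dbarLin`. [folklore] -/
theorem pushDir_eq_frame_add_dbarLin (L : ℕ) (W : Site d → Fin d → (Matrix n n ℂ)ˣ) (Y : Site d → Fin d → Matrix n n ℂ)
    (q : Site d) (κ : Fin d) :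
    pushDir L W Y q κ
      = (Ad (bavg L W q κ)⁻¹ (frameLin L W Y q) - frameLin L W Y (q + (L : ℤ) • e κ)) + dbarLin L W Y q κ := by
  rw [dbarLin, add_sub_cancel]

/-- The frame part on a coarse bond `(L·y, κ)` IS the coarse gauge direction generated by the frames read on the coarse
lattice: `Ad_{(cavg W)(y,κ)⁻¹} frameLin(L·y) − frameLin(L·y + L·e_κ) = gaugeDir (cavg L W) (frameLin ∘ L·) (y, κ)`. [folklore] -/
theorem frame_part_eq_gaugeDir (L : ℕ) (W : Site d → Fin d → (Matrix n n ℂ)ˣ) (Y : Site d → Fin d → Matrix n n ℂ) (y : Site d)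
    (κ : Fin d) :
    Ad (bavg L W ((L : ℤ) • y) κ)⁻¹ (frameLin L W Y ((L : ℤ) • y)) - frameLin L W Y ((L : ℤ) • y + (L : ℤ) • e κ)
      = gaugeDir (cavg L W) (fun z => frameLin L W Y ((L : ℤ) • z)) y κ := by
  simp only [gaugeDir, cavg, smul_add]

/-- **THE SPLIT ON THE COARSE LATTICE**: `pushDir L W Y (L·y, κ) = gaugeDir (cavg L W) (frameLin ∘ L·) (y, κ) + dbarLin L W Y (L·y, κ)`.
[folklore] -/
theorem pushDir_eq_gaugeDir_add_dbarLin (L : ℕ) (W : Site d → Fin d → (Matrix n n ℂ)ˣ) (Y : Site d → Fin d → Matrix n n ℂ)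
    (y : Site d) (κ : Fin d) :
    pushDir L W Y ((L : ℤ) • y) κ
      = gaugeDir (cavg L W) (fun z => frameLin L W Y ((L : ℤ) • z)) y κ + dbarLin L W Y ((L : ℤ) • y) κ := by
  rw [← frame_part_eq_gaugeDir, ← pushDir_eq_frame_add_dbarLin]

/-! ## §2 The flat background: `dbarLin 1 = L·Q₀` -/

section Flat

/-- The flat configuration `W ≡ 1`. [folklore] -/
abbrev flat : Site d → Fin d → (Matrix n n ℂ)ˣ := fun _ _ => 1

/-- At the flat background the linearised transport of one letter is the signed field value. [folklore] -/
theorem dstep_flat (Y : Site d → Fin d → Matrix n n ℂ) (x : Site d) (l : Letter d) :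
    dstep (flat (d := d) (n := n)) Y x l = stepA Y x l := by
  obtain ⟨μ, b⟩ := l
  cases b <;> simp [dstep, stepA, Ad]

/-- **At the flat background the linearised transport along a word is the abelian contour sum**: `(δ_Y 1)(Γ) = Y(Γ)`. [folklore] -/
theorem dhol_flat (Y : Site d → Fin d → Matrix n n ℂ) : ∀ (x : Site d) (w : List (Letter d)),
    dhol (flat (d := d) (n := n)) Y x w = asum Y x w
  | x, [] => by simp
  | x, l :: w => by
      rw [dhol_cons, asum_cons, dstep_flat, dhol_flat Y (x + l.vec) w]
      have h1 : stepHol (flat (d := d) (n := n)) x l = 1 := by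
        unfold stepHol; split <;> simp
      rw [h1]
      simp [Ad]

/-- The loop variables of the flat configuration are `1`. [folklore] -/
theorem Wcx_flat (L : ℕ) (q : Site d) (κ : Fin d) (r : Site d) : Wcx L (flat (d := d) (n := n)) q κ r = 1 := by
  rw [Wcx_eq_hol_loop, hol_flat]

/-- The exponent of (42) vanishes at the flat background. [folklore] -/
theorem Xavg_flat (L : ℕ) (q : Site d) (κ : Fin d) : Xavg L (flat (d := d) (n := n)) q κ = 0 := by
  unfold Xavg
  simp [Wcx_flat, MatrixLog.mlog_one]

/-- `J_0 = id`. [folklore] -/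
theorem jexp_zero_left (Y : Matrix n n ℂ) : jexp 0 Y = Y := by
  simp [jexp]

/-- At the flat background the derivative of `log W_{c,x}` is the contour sum over the loop `Γ_{c,x} ∪ (−Γ_c)`. [folklore] -/
theorem mlogDeriv_flat (L : ℕ) (Y : Site d → Fin d → Matrix n n ℂ) (q : Site d) (κ : Fin d) (r : Fin d → Fin L) :
    mlogDeriv L (flat (d := d) (n := n)) Y q κ (boxVec L r) = asum Y q (loopWord L κ (boxVec L r)) := by
  have hW : ‖((Wcx L (flat (d := d) (n := n)) q κ (boxVec L r) : (Matrix n n ℂ)ˣ) : Matrix n n ℂ) - 1‖ < 1 := by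
    rw [Wcx_flat, Units.val_one, sub_self, norm_zero]; exact one_pos
  have h := jexp_mlog_eq_Ad L (flat (d := d) (n := n)) Y q κ r hW
  rw [Wcx_flat, Units.val_one, MatrixLog.mlog_one, jexp_zero_left, inv_one, dhol_flat] at h
  rw [h]
  simp [Ad]

/-- … hence `X_c′ = Σ_x L^{−d} Y(Γ_{c,x} ∪ (−Γ_c))` at the flat background. [folklore] -/
theorem XavgDeriv_flat (L : ℕ) (Y : Site d → Fin d → Matrix n n ℂ) (q : Site d) (κ : Fin d) :
    XavgDeriv L (flat (d := d) (n := n)) Y q κ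
      = ∑ r : Fin d → Fin L, (((L : ℝ) ^ d)⁻¹) • asum Y q (loopWord L κ (boxVec L r)) := by
  unfold XavgDeriv
  exact Finset.sum_congr rfl fun r _ => by rw [mlogDeriv_flat]

/-- The weights of the block average sum to one: `Σ_{x∈B(c₋)} L^{−d} = 1` (`L ≥ 1`). [folklore] -/
theorem sum_blockWeight_eq_one (L : ℕ) (hL : 1 ≤ L) :
    ∑ _r : Fin d → Fin L, (((L : ℝ) ^ d)⁻¹ : ℝ) = 1 := by
  rw [Finset.sum_const, Finset.card_univ, Fintype.card_fun, Fintype.card_fin, Fintype.card_fin, nsmul_eq_mul]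
  have hL0 : (L : ℝ) ≠ 0 := by exact_mod_cast (by omega : L ≠ 0)
  push_cast
  field_simp

/-- **At the flat background the linearisation of (42) is Bałaban's first-order term `T_c`** ((47)–(48):
`T_c(Y) = Σ_{x∈B(c₋)} L^{−d} Y(Γ_{c,x})`): `pushDir L 1 Y (q, κ) = Tside L Y q κ`. [cite: Balaban1985Averaging, (47)–(48) p.25] -/
theorem pushDir_flat (L : ℕ) (hL : 1 ≤ L) (Y : Site d → Fin d → Matrix n n ℂ) (q : Site d) (κ : Fin d) :
    pushDir L (flat (d := d) (n := n)) Y q κ = Tside L Y q κ := by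
  have hb : bavg L (flat (d := d) (n := n)) q κ = 1 := by
    have := bavg_flat (d := d) (n := n) L
    exact congr_fun (congr_fun this q) κ
  simp only [pushDir, hb, inv_one, sideDeriv, Xavg_flat, expUnit_zero, jexp_zero_left, XavgDeriv_flat, dhol_flat]
  simp only [Ad, Units.val_one, inv_one, one_mul, mul_one]
  -- `Σ_x L^{-d} [Y(Γ_{c,x}) − Y(Γ_c)] + Y(Γ_c) = Σ_x L^{-d} Y(Γ_{c,x})`
  have hloop : ∀ r : Fin d → Fin L,
      asum Y q (loopWord L κ (boxVec L r)) = asum Y q (gammaWord L κ (boxVec L r)) - asum Y q (seg κ L) := by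
    intro r
    rw [loopWord, asum_append, disp_gammaWord, asum_seg_neg, add_sub_cancel_right, sub_eq_add_neg]
  simp only [hloop, smul_sub, Finset.sum_sub_distrib, ← Finset.sum_smul, sum_blockWeight_eq_one L hL, one_smul,
    sub_add_cancel, Tside]

/-- At the flat background the linearised frame is `F̂(y) = Σ_x L^{−d} Y(Γ_{y,x})` (B7 (112) at `V₀ = 1`, tree `B7Prop3Flat.Fhat`).
[cite: Balaban1985Averaging, (112) p.34] -/
theorem frameLin_flat (L : ℕ) (Y : Site d → Fin d → Matrix n n ℂ) (y : Site d) :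
    frameLin L (flat (d := d) (n := n)) Y y = Fhat L Y y := by
  unfold frameLin Fhat
  exact Finset.sum_congr rfl fun r _ => by rw [dhol_flat]

/-- **AT THE FLAT BACKGROUND THE LINEARISED DOUBLE-BAR AVERAGE IS BAŁABAN'S `L·Q₀`** ((122)∕(125):
`L·(Q₀Y)_c = Σ_{x ∈ B(c₋)} L^{−d} Y([x, x + Le_κ])` — only the straight segments survive once the frames are removed; tree
`B7Prop3Flat.frame_cancellation` BY NAME). [cite: Balaban1985Averaging, (122) p.36, (125) p.36] -/
theorem dbarLin_flat (L : ℕ) (hL : 1 ≤ L) (Y : Site d → Fin d → Matrix n n ℂ) (q : Site d) (κ : Fin d) :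
    dbarLin L (flat (d := d) (n := n)) Y q κ = linQ L Y q κ := by
  have hb : bavg L (flat (d := d) (n := n)) q κ = 1 := by
    have := bavg_flat (d := d) (n := n) L
    exact congr_fun (congr_fun this q) κ
  rw [dbarLin, pushDir_flat L hL, hb, inv_one, frameLin_flat, frameLin_flat, ← frame_cancellation L Y q κ]
  simp only [Ad, Units.val_one, inv_one, one_mul, mul_one]
  abel

end Flat

/-! ## §3 The two operator norms of the flat main term `L·Q₀` -/

/-- **SUP NORM `≤ L`**: `‖L·(Q₀Y)_c‖ ≤ L·s` when `‖Y(b)‖ ≤ s` on the bonds within `l¹`-distance `dL + L` of `c₋` (tree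
`B7Prop3Flat.norm_linQ_le` BY NAME) — smooth directions are amplified by exactly `L` per averaging step. [folklore] -/
theorem norm_linQ_le_sup (L : ℕ) (hL : 1 ≤ L) (Y : Site d → Fin d → Matrix n n ℂ) (q : Site d) (κ : Fin d) {s : ℝ}
    (hs : 0 ≤ s) (hY : ∀ (x : Site d) (μ : Fin d), l1 (x - q) ≤ d * L + L → ‖Y x μ‖ ≤ s) :
    ‖linQ L Y q κ‖ ≤ L * s :=
  norm_linQ_le Y q (d * L + L) hs hY L hL q κ (by simp [l1])

/-- `‖L·(Q₀Y)_c‖ ≤ Σ_{x∈B(c₋)} L^{−d} Σ_{i<L} ‖Y(x + ie_κ, κ)‖` (term by term). [folklore] -/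
theorem norm_linQ_le_sum (L : ℕ) (Y : Site d → Fin d → Matrix n n ℂ) (q : Site d) (κ : Fin d) :
    ‖linQ L Y q κ‖ ≤ ∑ r : Fin d → Fin L, ((L : ℝ) ^ d)⁻¹ *
      ∑ i ∈ Finset.range L, ‖Y (q + boxVec L r + (i : ℤ) • e κ) κ‖ := by
  unfold linQ
  refine (norm_sum_le _ _).trans (Finset.sum_le_sum fun r _ => ?_)
  rw [norm_smul, norm_inv, norm_pow, Real.norm_natCast, seg_natCast, ← seg_natCast, asum_seg_natCast]
  exact mul_le_mul_of_nonneg_left (norm_sum_le _ _) (by positivity)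

/-- **`ℓ¹` CONTRACTION `≤ L^{1−d}`**: on the torus `[0,LM)^d`, for an `LM`-periodic direction `Y`,
`Σ_{y∈[0,M)^d} Σ_κ ‖L·(Q₀Y)(L·y, κ)‖ ≤ L^{1−d} · Σ_{x∈[0,LM)^d} Σ_κ ‖Y(x, κ)‖` — every fine bond lies on exactly `L` of the straight
segments `[x, x + Le_κ]`, `x` a block site, each weighted `L^{−d}`: localised directions are CONTRACTED by `L^{1−d}` per step
(the blocks tile the period, `sum_blocks_eq` + `blockSites_periodBox`; shift invariance `sum_periodBox_shift`). [folklore] -/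
theorem sum_period_norm_linQ_le {L M : ℕ} (hL : 1 ≤ L) (hM : 1 ≤ M) (Y : Site d → Fin d → Matrix n n ℂ)
    (hY : IsPeriodicDir Y ((L : ℤ) * M)) :
    ∑ y ∈ periodBox M, ∑ κ : Fin d, ‖linQ L Y ((L : ℤ) • y) κ‖
      ≤ (L : ℝ) / (L : ℝ) ^ d * dirL1 Y (periodBox (L * M)) := by
  have hLM : 1 ≤ L * M := Nat.one_le_iff_ne_zero.mpr (Nat.mul_ne_zero (by omega) (by omega))
  have hper : ∀ (κ : Fin d) (x : Site d) (i : Fin d), ‖Y (x + ((L * M : ℕ) : ℤ) • e i) κ‖ = ‖Y x κ‖ := by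
    intro κ x i
    rw [show (((L * M : ℕ) : ℤ)) = (L : ℤ) * M by push_cast; ring, hY x i κ]
  set w : ℝ := ((L : ℝ) ^ d)⁻¹ with hw
  set f : Fin d → ℕ → Site d → (Fin d → Fin L) → ℝ :=
    fun κ i y r => ‖Y ((L : ℤ) • y + boxVec L r + (i : ℤ) • e κ) κ‖ with hf
  -- the tiling of the period by blocks, then the shift by `i e_κ`
  have htile : ∀ (κ : Fin d) (i : ℕ),
      ∑ y ∈ periodBox M, ∑ r : Fin d → Fin L, f κ i y r = ∑ x ∈ periodBox (L * M), ‖Y x κ‖ := by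
    intro κ i
    simp only [hf]
    rw [sum_blocks_eq L hL (periodBox M) (fun x => ‖Y (x + (i : ℤ) • e κ) κ‖), blockSites_periodBox L M hL]
    exact sum_periodBox_shift (L * M) hLM (g := fun x => ‖Y x κ‖) (hper κ) ((i : ℤ) • e κ)
  calc ∑ y ∈ periodBox M, ∑ κ : Fin d, ‖linQ L Y ((L : ℤ) • y) κ‖
      ≤ ∑ y ∈ periodBox M, ∑ κ : Fin d, ∑ r : Fin d → Fin L, w * ∑ i ∈ Finset.range L, f κ i y r :=
        Finset.sum_le_sum fun y _ => Finset.sum_le_sum fun κ _ => norm_linQ_le_sum L Y _ κ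
    _ = ∑ κ : Fin d, ∑ y ∈ periodBox M, ∑ r : Fin d → Fin L, w * ∑ i ∈ Finset.range L, f κ i y r :=
        Finset.sum_comm
    _ = ∑ κ : Fin d, ∑ i ∈ Finset.range L, w * ∑ y ∈ periodBox M, ∑ r : Fin d → Fin L, f κ i y r := by
        refine Finset.sum_congr rfl fun κ _ => ?_
        calc ∑ y ∈ periodBox M, ∑ r : Fin d → Fin L, w * ∑ i ∈ Finset.range L, f κ i y r
            = ∑ y ∈ periodBox M, ∑ r : Fin d → Fin L, ∑ i ∈ Finset.range L, w * f κ i y r := by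
              simp only [Finset.mul_sum]
          _ = ∑ y ∈ periodBox M, ∑ i ∈ Finset.range L, ∑ r : Fin d → Fin L, w * f κ i y r :=
              Finset.sum_congr rfl fun y _ => Finset.sum_comm
          _ = ∑ i ∈ Finset.range L, ∑ y ∈ periodBox M, ∑ r : Fin d → Fin L, w * f κ i y r := Finset.sum_comm
          _ = ∑ i ∈ Finset.range L, w * ∑ y ∈ periodBox M, ∑ r : Fin d → Fin L, f κ i y r := by
              simp only [Finset.mul_sum]
    _ = ∑ κ : Fin d, ∑ _i ∈ Finset.range L, w * ∑ x ∈ periodBox (L * M), ‖Y x κ‖ := by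
        refine Finset.sum_congr rfl fun κ _ => Finset.sum_congr rfl fun i _ => ?_
        rw [htile κ i]
    _ = (L : ℝ) / (L : ℝ) ^ d * dirL1 Y (periodBox (L * M)) := by
        simp only [Finset.sum_const, Finset.card_range, nsmul_eq_mul, hw]
        rw [dirL1, Finset.sum_comm, Finset.mul_sum]
        refine Finset.sum_congr rfl fun κ _ => ?_
        ring

end

end Summit.QuantumFields.BalabanUV.T4Continuum.BlockAveragePushDirSplit
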